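import Literature.NumberTheory.LFunctions.GaussianThetaSeries
import Mathlib.Analysis.SpecialFunctions.Complex.CircleAddChar
import HarnessLib

/-!
# Theta inversion and the functional equation of weight-one theta series of `ℤ[i]`

Sequel to `Literature.NumberTheory.LFunctions.GaussianThetaSeries`, which attached to a
coefficient `ψ : ℤ[i] → ℂ` periodic modulo `M` the weight-one theta function
`θ_ψ(t) = ∑_{x ∈ ℤ[i]} ψ(x) x e^{-π t N(x)/M}` (`Literature.NumberTheory.LFunctions.GaussianTheta.theta`), its Mellin transform
and the entire function `thetaLFunction M ψ` continuing `∑_x ψ(x) x N(x)^{-s}`. Here we prove the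
**theta inversion formula** and the resulting **functional equation** (Hecke 1920, §9; Koblitz,
*Introduction to Elliptic Curves and Modular Forms*, Ch. II §5, proof of the Theorem — "the
functional equation for `L(E_n, s)`" is obtained there from exactly this inversion of the
two-variable theta series):

* `Literature.GaussianTheta.fourier M ψ` — the finite Fourier transform
  `ψ̂(y) = ∑_{c mod M} ψ(c) e^{2πi Re(c ȳ)/M}` (`Re(c ȳ) = c₁ y₁ + c₂ y₂`), periodic modulo `M`;
* `Literature.NumberTheory.LFunctions.GaussianTheta.theta_eq_fourier` — **`θ_ψ(t) = -(i/M) t^{-2} θ_{ψ̂}(1/t)`** for `t > 0`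
  (Poisson summation on `ℤ²`, through the functional equations of Mathlib's one-dimensional
  kernels `oddKernel`/`evenKernel` ↔ `sinKernel`/`cosKernel`, already packaged as
  `classTheta_eq_of_pos`, and the double series of the dual kernels, `hasSum_dualClassTheta`);
* `Literature.NumberTheory.LFunctions.GaussianTheta.mellin_theta_eq_fourier` — `∫₀^∞ θ_ψ t^{s-1} dt = -(i/M) ∫₀^∞ θ_{ψ̂} t^{1-s} dt`
  for **all** `s` (both sides entire), and `thetaLFunction_one_eq_fourier`:
  `L(ψ, 1) = -(i/M) L(ψ̂, 1)`;
* `Literature.NumberTheory.LFunctions.GaussianTheta.theta_eq_of_support`, `mellin_theta_eq_of_support` — if `φ` vanishes off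
  `ν ℤ[i]` and `φ(ν y) = C ψ(y)`, then `θ_φ(t) = C ν θ_ψ(N(ν) t)` and
  `∫ θ_φ t^{s-1} = C ν N(ν)^{-s} ∫ θ_ψ t^{s-1}`;
* `Literature.NumberTheory.LFunctions.GaussianTheta.mellin_theta_functional_equation` — hence, when `ψ̂` vanishes off `ν ℤ[i]`
  and `ψ̂(ν y) = C ψ(y)` (the shape of the transform of a character of conductor `M/ν̄`), the
  **functional equation** `Λ(s) = w N(ν)^{s-1} Λ(2 - s)` for `Λ(s) = ∫₀^∞ θ_ψ t^{s-1} dt =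
  (M/π)^s Γ(s) ∑ ψ(x) x N(x)^{-s}` with `w = -i C ν /(M N(ν))`, and
  `mellin_theta_one_eq_zero` / `thetaLFunction_one_eq_zero`: **if `w = -1` then `L(ψ, 1) = 0`**.

The arithmetic input — the evaluation of `ψ̂` for the coefficient `ψ_n` of `L(E_n, s)`, i.e. the
root number of the congruent number curve — is in
`Literature.NumberTheory.EllipticCurves.CongruentNumberCurveRootNumber`. Also recorded, for that
computation: the Chinese-remainder factorisation of `ψ̂` for a product coefficient modulo coprime
`M₁ M₂` (`fourier_mul_eq_of_coprime`).

## References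

* E. Hecke, *Eine neue Art von Zetafunktionen und ihre Beziehungen zur Verteilung der
  Primzahlen. II*, Math. Z. 6 (1920) 11–51, §9.
* N. Koblitz, *Introduction to Elliptic Curves and Modular Forms*, GTM 97, 2nd ed. (1993),
  Ch. II §5, Theorem (p. 84) and its proof (theta inversion, functional equation, root number)
  — not held; locator as quoted by Top–Yui, MSRI Publ. 44 (2008), p. 627.
-/

noncomputable section

open Complex Real Set Filter Topology Asymptotics MeasureTheory HurwitzZeta

namespace Literature.NumberTheory.LFunctions

namespace GaussianTheta

local notation "ℤ[i]" => GaussianInt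

variable (M : ℕ) [NeZero M]

/-! ### Periodic coefficients: values on a class -/

omit [NeZero M] in
/-- A coefficient periodic modulo `M` takes the same value on two Gaussian integers with the same
class modulo `M`. [folklore] -/
theorem apply_eq_of_cls_eq {ψ : ℤ[i] → ℂ} (hψ : ∀ x y : ℤ[i], ψ (x + M * y) = ψ x)
    {x x' : ℤ[i]} (h : cls M x = cls M x') : ψ x = ψ x' := by
  rcases eq_or_ne M 0 with hM | hM
  · subst hM
    have h1 : (x.re : ZMod 0) = x'.re := congrArg Prod.fst h
    have h2 : (x.im : ZMod 0) = x'.im := congrArg Prod.snd h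
    rw [show x = x' from Zsqrtd.ext (Int.cast_injective h1) (Int.cast_injective h2)]
  · haveI : NeZero M := ⟨hM⟩
    obtain ⟨y, hy⟩ := exists_rep_eq M (c := cls M x') h
    obtain ⟨y', hy'⟩ := exists_rep_eq M (c := cls M x') rfl
    have e1 : ψ x = ψ (rep M (cls M x') 0) := by
      rw [← hy, rep_eq_rep_zero_add M (cls M x') y, hψ]
    have e2 : ψ x' = ψ (rep M (cls M x') 0) := by
      conv_lhs => rw [← hy', rep_eq_rep_zero_add M (cls M x') y', hψ]
    rw [e1, e2]

/-! ### The finite Fourier transform modulo `M` -/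

/-- The additive character `e^{2πi (c₁ y₁ + c₂ y₂)/M} = e^{2πi Re(c ȳ)/M}` pairing a class `c`
modulo `M` with `y ∈ ℤ[i]` (Mathlib's `ZMod.stdAddChar`). [folklore] -/
def pairing (c : ZMod M × ZMod M) (y : ℤ[i]) : ℂ :=
  ZMod.stdAddChar (c.1 * (y.re : ZMod M) + c.2 * (y.im : ZMod M))

/-- The finite Fourier transform of a coefficient modulo `M`:
`ψ̂(y) = ∑_{c mod M} ψ(c) e^{2πi Re(c ȳ)/M}` (Hecke 1920 §9; Koblitz Ch. II §5, the "Gauss sum"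
side of the theta inversion). [folklore] -/
def fourier (ψ : ℤ[i] → ℂ) (y : ℤ[i]) : ℂ :=
  ∑ c : ZMod M × ZMod M, ψ (rep M c 0) * pairing M c y

/-- The pairing only depends on `y` modulo `M`. [folklore] -/
@[simp] lemma pairing_add_mul (c : ZMod M × ZMod M) (y z : ℤ[i]) :
    pairing M c (y + M * z) = pairing M c y := by
  simp [pairing]

/-- **`ψ̂` is periodic modulo `M`.** [folklore] -/
theorem fourier_add_mul (ψ : ℤ[i] → ℂ) (y z : ℤ[i]) :
    fourier M ψ (y + M * z) = fourier M ψ y := by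
  simp [fourier]

/-- The pairing as an exponential: `e^{2πi (c₁ n + c₂ m)/M}` for `y = n + m i`. [folklore] -/
lemma pairing_eq_exp (c : ZMod M × ZMod M) (y : ℤ[i]) :
    pairing M c y = cexp (2 * π * I * ((c.1.val : ℤ) * y.re + (c.2.val : ℤ) * y.im : ℤ) / M) := by
  rw [pairing, ← ZMod.stdAddChar_coe]
  congr 1
  push_cast
  rw [ZMod.natCast_zmod_val, ZMod.natCast_zmod_val]

/-! ### The dual class series -/

/-- **The dual kernel combination as a double series**: for `u > 0`,
`g_c(u) = -i ∑_{(n, m) ∈ ℤ²} (n + m i) e^{2πi (c₁ n + c₂ m)/M} e^{-π (n² + m²) u}`, from Mathlib's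
`hasSum_int_sinKernel` / `hasSum_int_cosKernel`. [folklore] -/
lemma hasSum_dualClassTheta (c : ZMod M × ZMod M) {u : ℝ} (hu : 0 < u) :
    HasSum (fun y : ℤ × ℤ ↦ -I * ((y.1 : ℂ) + (y.2 : ℂ) * I) * pairing M c ⟨y.1, y.2⟩ *
      (rexp (-π * u * ((y.1 : ℝ) ^ 2 + (y.2 : ℝ) ^ 2)) : ℂ)) (dualClassTheta M c u) := by
  unfold dualClassTheta
  set a : ℝ := (c.1.val : ℝ) / M with ha
  set b : ℝ := (c.2.val : ℝ) / M with hb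
  let fS : ℝ → ℤ → ℂ := fun a' n ↦ -I * n * cexp (2 * π * I * a' * n) * rexp (-π * n ^ 2 * u)
  let fC : ℝ → ℤ → ℂ := fun a' n ↦ cexp (2 * π * I * a' * n) * rexp (-π * n ^ 2 * u)
  have hS (a' : ℝ) : HasSum (fS a') (sinKernel (a' : UnitAddCircle) u : ℂ) :=
    hasSum_int_sinKernel a' hu
  have hC (a' : ℝ) : HasSum (fC a') (cosKernel (a' : UnitAddCircle) u : ℂ) :=
    hasSum_int_cosKernel a' hu
  have hexp1 (a' : ℝ) (n : ℤ) : ‖cexp (2 * π * I * a' * n)‖ = 1 := by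
    rw [show 2 * (π : ℂ) * I * a' * n = ((2 * π * a' * n : ℝ) : ℂ) * I by push_cast; ring,
      Complex.norm_exp_ofReal_mul_I]
  have hnS (a' : ℝ) : Summable fun n : ℤ ↦ ‖fS a' n‖ := by
    refine (HurwitzKernelBounds.summable_f_int 1 0 hu).congr fun n ↦ ?_
    simp only [fS, HurwitzKernelBounds.f_int, add_zero, pow_one, norm_mul, norm_neg, norm_I,
      one_mul, hexp1, mul_one, norm_real, Real.norm_eq_abs, abs_of_pos (Real.exp_pos _),
      norm_intCast]
  have hnC (a' : ℝ) : Summable fun n : ℤ ↦ ‖fC a' n‖ := by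
    refine (HurwitzKernelBounds.summable_f_int 0 0 hu).congr fun n ↦ ?_
    simp only [fC, HurwitzKernelBounds.f_int, add_zero, pow_zero, norm_mul, hexp1, one_mul,
      norm_real, Real.norm_eq_abs, abs_of_pos (Real.exp_pos _)]
  have hP₁ : HasSum (fun y : ℤ × ℤ ↦ fS a y.1 * fC b y.2)
      ((sinKernel (a : UnitAddCircle) u : ℂ) * (cosKernel (b : UnitAddCircle) u : ℂ)) :=
    (hS a).mul (hC b) (summable_mul_of_summable_norm (hnS a) (hnC b))
  have hP₂ : HasSum (fun y : ℤ × ℤ ↦ fC a y.1 * fS b y.2)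
      ((cosKernel (a : UnitAddCircle) u : ℂ) * (sinKernel (b : UnitAddCircle) u : ℂ)) :=
    (hC a).mul (hS b) (summable_mul_of_summable_norm (hnC a) (hnS b))
  refine (hP₁.add (hP₂.mul_left I)).congr_fun fun y ↦ ?_
  simp only [fS, fC]
  have hpair : pairing M c ⟨y.1, y.2⟩ = cexp (2 * π * I * a * y.1) * cexp (2 * π * I * b * y.2) := by
    rw [pairing_eq_exp, ← Complex.exp_add, ha, hb]
    have hM : (M : ℂ) ≠ 0 := Nat.cast_ne_zero.mpr (NeZero.ne M)
    congr 1
    push_cast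
    field_simp
  have hexp : (rexp (-π * u * ((y.1 : ℝ) ^ 2 + (y.2 : ℝ) ^ 2)) : ℂ) =
      (rexp (-π * y.1 ^ 2 * u) : ℂ) * (rexp (-π * y.2 ^ 2 * u) : ℂ) := by
    rw [← Complex.ofReal_mul, ← Real.exp_add]
    congr 1
    ring_nf
  rw [hpair, hexp]
  ring

/-! ### Theta inversion -/

omit [NeZero M] in
/-- The lattice `ℤ × ℤ ≃ ℤ[i]`. [folklore] -/
def prodEquiv : ℤ × ℤ ≃ ℤ[i] where
  toFun p := ⟨p.1, p.2⟩
  invFun x := (x.re, x.im)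
  left_inv _ := rfl
  right_inv _ := rfl

/-- **`∑_c ψ(c) g_c(u) = -i θ_{ψ̂}`**: the `ψ`-combination of the dual kernels is the theta series
of the Fourier transform, `∑_c ψ(c) g_c(1/(M t)) = -i θ_{ψ̂}(1/t)`. [folklore] -/
theorem sum_mul_dualClassTheta (ψ : ℤ[i] → ℂ) {t : ℝ} (ht : 0 < t) :
    ∑ c : ZMod M × ZMod M, ψ (rep M c 0) * dualClassTheta M c (1 / (M * t)) =
      -I * theta M (fourier M ψ) (1 / t) := by
  have hM : (0 : ℝ) < M := by exact_mod_cast Nat.pos_of_ne_zero (NeZero.ne M)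
  have hu : 0 < 1 / ((M : ℝ) * t) := by positivity
  -- the left side as a double series
  have hL := hasSum_sum (s := (Finset.univ : Finset (ZMod M × ZMod M)))
    fun c _ ↦ (hasSum_dualClassTheta M c hu).mul_left (ψ (rep M c 0))
  -- the right side as a double series
  have hR₀ := (hasSum_theta M (fourier M ψ) (fourier_add_mul M ψ) (one_div_pos.mpr ht)).mul_left
    (-I)
  have hR := (prodEquiv.hasSum_iff (f := fun x ↦ -I * thetaTerm M (fourier M ψ) (1 / t) x)).mpr hR₀
  refine hL.unique (hR.congr_fun fun y ↦ ?_)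
  simp only [Function.comp_apply, prodEquiv, Equiv.coe_fn_mk, thetaTerm, fourier,
    Finset.sum_mul, Finset.mul_sum]
  refine Finset.sum_congr rfl fun c _ ↦ ?_
  have hz : (((⟨y.1, y.2⟩ : ℤ[i]) : ℤ[i]) : ℂ) = (y.1 : ℂ) + (y.2 : ℂ) * I :=
    GaussianInt.toComplex_def' y.1 y.2
  have hN : (((⟨y.1, y.2⟩ : ℤ[i]).norm : ℝ)) = (y.1 : ℝ) ^ 2 + (y.2 : ℝ) ^ 2 := by
    rw [Zsqrtd.norm_def]
    push_cast
    ring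
  have hexp : rexp (-π * (1 / t) * (((⟨y.1, y.2⟩ : ℤ[i]).norm : ℝ)) / M) =
      rexp (-π * (1 / (M * t)) * ((y.1 : ℝ) ^ 2 + (y.2 : ℝ) ^ 2)) := by
    rw [hN]
    congr 1
    field_simp
  rw [hz, hexp]
  ring

/-- **Theta inversion** (Hecke 1920 §9; Koblitz, Ch. II §5, proof of the Theorem): for
`ψ : ℤ[i] → ℂ` periodic modulo `M` and `t > 0`,
`θ_ψ(t) = -(i/M) t^{-2} θ_{ψ̂}(1/t)`, where `ψ̂ = fourier M ψ`. [folklore] -/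
theorem theta_eq_fourier (ψ : ℤ[i] → ℂ) {t : ℝ} (ht : 0 < t) :
    theta M ψ t = -I / M * ((t ^ (-(2 : ℝ)) : ℝ) : ℂ) * theta M (fourier M ψ) (1 / t) := by
  have hM : (0 : ℝ) < M := by exact_mod_cast Nat.pos_of_ne_zero (NeZero.ne M)
  have hMc : (M : ℂ) ≠ 0 := Nat.cast_ne_zero.mpr (NeZero.ne M)
  have h1 : theta M ψ t = (M : ℂ) * ((((M : ℝ) * t) ^ (-(2 : ℝ)) : ℝ) : ℂ) *
      ∑ c : ZMod M × ZMod M, ψ (rep M c 0) * dualClassTheta M c (1 / (M * t)) := by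
    rw [theta, Finset.mul_sum]
    refine Finset.sum_congr rfl fun c _ ↦ ?_
    rw [classTheta_eq_of_pos M c ht]
    ring
  rw [h1, sum_mul_dualClassTheta M ψ ht, Real.mul_rpow hM.le ht.le,
    show ((M : ℝ) ^ (-(2 : ℝ))) = ((M : ℝ) ^ 2)⁻¹ by
      rw [Real.rpow_neg hM.le, Real.rpow_two]]
  push_cast
  field_simp

/-! ### The functional equation of the Mellin transform -/

/-- **Functional equation, transform form**: for `ψ` periodic modulo `M` and every `s`,
`∫₀^∞ θ_ψ(t) t^{s-1} dt = -(i/M) ∫₀^∞ θ_{ψ̂}(t) t^{1-s} dt` (from theta inversion; both sides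
are entire, `differentiable_mellin_theta`, so no convergence hypothesis is needed: Mathlib's
`mellin_cpow_smul`, `mellin_comp_inv` are unconditional). Hecke 1920 §9; Koblitz Ch. II §5.
[folklore] -/
theorem mellin_theta_eq_fourier (ψ : ℤ[i] → ℂ) (s : ℂ) :
    mellin (theta M ψ) s = -I / M * mellin (theta M (fourier M ψ)) (2 - s) := by
  set f : ℝ → ℂ := fun t ↦ theta M (fourier M ψ) t⁻¹ with hf
  have h1 : mellin (theta M ψ) s = mellin (fun t ↦ (-I / M) • ((t : ℂ) ^ (-2 : ℂ) • f t)) s := by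
    refine setIntegral_congr_fun measurableSet_Ioi fun t (ht : 0 < t) ↦ ?_
    simp only [smul_eq_mul, hf]
    rw [theta_eq_fourier M ψ ht, one_div, Complex.ofReal_cpow ht.le]
    push_cast
    ring
  rw [h1, mellin_const_smul, mellin_cpow_smul f s (-2), hf, mellin_comp_inv, smul_eq_mul]
  congr 1
  ring

/-- **`L(ψ, 1) = -(i/M) L(ψ̂, 1)`**: the value at the centre `s = 1` of the entire function
`thetaLFunction M ψ` (`= ∑ ψ(x) x N(x)^{-s}` for `Re s > 3/2`) against that of the transform.
[folklore] -/
theorem thetaLFunction_one_eq_fourier (ψ : ℤ[i] → ℂ) :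
    thetaLFunction M ψ 1 = -I / M * thetaLFunction M (fourier M ψ) 1 := by
  unfold thetaLFunction
  rw [mellin_theta_eq_fourier M ψ 1, show (2 : ℂ) - 1 = 1 by norm_num]
  ring

/-! ### Coefficients supported on a sublattice `ν ℤ[i]` -/

/-- **Rescaling**: if `φ` vanishes off `ν ℤ[i]` (`ν ≠ 0`) and `φ(ν y) = C ψ(y)`, then
`θ_φ(t) = C ν θ_ψ(N(ν) t)` for `t > 0` (reindex the absolutely convergent series
`∑_x φ(x) x e^{-π t N(x)/M}` along the injection `y ↦ ν y`, `N(ν y) = N(ν) N(y)`). [folklore] -/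
theorem theta_eq_of_support {φ ψ : ℤ[i] → ℂ} (hφ : ∀ x y : ℤ[i], φ (x + M * y) = φ x)
    (hψ : ∀ x y : ℤ[i], ψ (x + M * y) = ψ x) {ν : ℤ[i]} (hν : ν ≠ 0) {C : ℂ}
    (hoff : ∀ y, ¬ ν ∣ y → φ y = 0) (hon : ∀ y, φ (ν * y) = C * ψ y) {t : ℝ} (ht : 0 < t) :
    theta M φ t = C * ν * theta M ψ ((ν.norm : ℝ) * t) := by
  have hNν : (0 : ℝ) < (ν.norm : ℝ) := by exact_mod_cast GaussianInt.norm_pos.2 hν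
  have h1 := hasSum_theta M φ hφ ht
  have h2 := (hasSum_theta M ψ hψ (mul_pos hNν ht)).mul_left (C * ν)
  have hinj : Function.Injective (fun y : ℤ[i] ↦ ν * y) := mul_right_injective₀ hν
  have hoff' : ∀ x ∉ Set.range (fun y : ℤ[i] ↦ ν * y), thetaTerm M φ t x = 0 := by
    intro x hx
    have : φ x = 0 := hoff x (by rintro ⟨y, rfl⟩; exact hx ⟨y, rfl⟩)
    simp [thetaTerm, this]
  have h3 := (hinj.hasSum_iff hoff').2 h1
  refine h3.unique (h2.congr_fun fun y ↦ ?_)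
  simp only [Function.comp_apply, thetaTerm]
  rw [hon y, Zsqrtd.norm_mul, map_mul GaussianInt.toComplex, Int.cast_mul]
  have : rexp (-π * t * ((ν.norm : ℝ) * (y.norm : ℝ)) / M) =
      rexp (-π * ((ν.norm : ℝ) * t) * (y.norm : ℝ) / M) := by ring_nf
  rw [this]
  push_cast
  ring

/-- Mellin form of the rescaling: `∫ θ_φ t^{s-1} = C ν N(ν)^{-s} ∫ θ_ψ t^{s-1}`. [folklore] -/
theorem mellin_theta_eq_of_support {φ ψ : ℤ[i] → ℂ} (hφ : ∀ x y : ℤ[i], φ (x + M * y) = φ x)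
    (hψ : ∀ x y : ℤ[i], ψ (x + M * y) = ψ x) {ν : ℤ[i]} (hν : ν ≠ 0) {C : ℂ}
    (hoff : ∀ y, ¬ ν ∣ y → φ y = 0) (hon : ∀ y, φ (ν * y) = C * ψ y) (s : ℂ) :
    mellin (theta M φ) s = C * ν * (ν.norm : ℂ) ^ (-s) * mellin (theta M ψ) s := by
  have hNν : (0 : ℝ) < (ν.norm : ℝ) := by exact_mod_cast GaussianInt.norm_pos.2 hν
  have h1 : mellin (theta M φ) s =
      mellin (fun t ↦ (C * (ν : ℂ)) • theta M ψ ((ν.norm : ℝ) * t)) s := by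
    refine setIntegral_congr_fun measurableSet_Ioi fun t (ht : 0 < t) ↦ ?_
    simp only [smul_eq_mul]
    rw [theta_eq_of_support M hφ hψ hν hoff hon ht]
  rw [h1, mellin_const_smul, mellin_comp_mul_left _ _ hNν, smul_eq_mul, smul_eq_mul]
  push_cast
  ring

/-- **Functional equation of `Λ_ψ(s) = ∫₀^∞ θ_ψ(t) t^{s-1} dt = (M/π)^s Γ(s) ∑ ψ(x) x N(x)^{-s}`**
(Hecke 1920 §9; Koblitz, Ch. II §5, Theorem): if the Fourier transform `ψ̂` vanishes off `ν ℤ[i]`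
and `ψ̂(ν y) = C ψ(y)` — the shape `ψ̂ = (Gauss sum) · ψ` of the transform of a primitive
character, up to the index `ν` between the period `M` and the conductor —, then for every `s`
`Λ_ψ(s) = -(i C ν/M) N(ν)^{s-2} Λ_ψ(2 - s)`. [folklore] -/
theorem mellin_theta_functional_equation {ψ : ℤ[i] → ℂ}
    (hψ : ∀ x y : ℤ[i], ψ (x + M * y) = ψ x) {ν : ℤ[i]} (hν : ν ≠ 0) {C : ℂ}
    (hoff : ∀ y, ¬ ν ∣ y → fourier M ψ y = 0) (hon : ∀ y, fourier M ψ (ν * y) = C * ψ y)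
    (s : ℂ) :
    mellin (theta M ψ) s =
      -I / M * (C * ν * (ν.norm : ℂ) ^ (s - 2)) * mellin (theta M ψ) (2 - s) := by
  have h1 := mellin_theta_eq_fourier M ψ s
  have h2 := mellin_theta_eq_of_support M (fourier_add_mul M ψ) hψ hν hoff hon (2 - s)
  have h3 : (ν.norm : ℂ) ^ (-(2 - s)) = (ν.norm : ℂ) ^ (s - 2) := by rw [neg_sub]
  rw [h1, h2, h3]
  ring

/-- **Root number `-1` forces a central zero**: under the hypotheses of
`mellin_theta_functional_equation`, if the sign `w = -(i C ν)/(M N(ν))` of the functional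
equation at the centre is `-1`, then `∫₀^∞ θ_ψ(t) dt = 0`. [folklore] -/
theorem mellin_theta_one_eq_zero {ψ : ℤ[i] → ℂ}
    (hψ : ∀ x y : ℤ[i], ψ (x + M * y) = ψ x) {ν : ℤ[i]} (hν : ν ≠ 0) {C : ℂ}
    (hoff : ∀ y, ¬ ν ∣ y → fourier M ψ y = 0) (hon : ∀ y, fourier M ψ (ν * y) = C * ψ y)
    (hw : -I / M * (C * ν * ((ν.norm : ℂ))⁻¹) = -1) :
    mellin (theta M ψ) 1 = 0 := by
  have h := mellin_theta_functional_equation M hψ hν hoff hon 1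
  rw [show (1 : ℂ) - 2 = -1 by norm_num, show (2 : ℂ) - 1 = 1 by norm_num, cpow_neg_one,
    hw] at h
  linear_combination h / 2

/-- **`L(ψ, 1) = 0` when the root number is `-1`** (Koblitz, Ch. II §5–6: "if
`n ≡ 5, 6, 7 (mod 8)` … `L(E_n, 1) = 0`", the mechanism in general form): under the hypotheses
of `mellin_theta_functional_equation` with `-(i C ν)/(M N(ν)) = -1`, the entire function
`thetaLFunction M ψ` (`= ∑ ψ(x) x N(x)^{-s}` for `Re s > 3/2`) vanishes at `s = 1`. [folklore] -/
theorem thetaLFunction_one_eq_zero {ψ : ℤ[i] → ℂ}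
    (hψ : ∀ x y : ℤ[i], ψ (x + M * y) = ψ x) {ν : ℤ[i]} (hν : ν ≠ 0) {C : ℂ}
    (hoff : ∀ y, ¬ ν ∣ y → fourier M ψ y = 0) (hon : ∀ y, fourier M ψ (ν * y) = C * ψ y)
    (hw : -I / M * (C * ν * ((ν.norm : ℂ))⁻¹) = -1) :
    thetaLFunction M ψ 1 = 0 := by
  unfold thetaLFunction
  rw [mellin_theta_one_eq_zero M hψ hν hoff hon hw, mul_zero]

/-- The primitive case `ν = 1`: if `ψ̂ = C ψ` then `Λ_ψ(s) = -(i C/M) Λ_ψ(2 - s)`. [folklore] -/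
theorem mellin_theta_functional_equation_of_eq {ψ : ℤ[i] → ℂ}
    (hψ : ∀ x y : ℤ[i], ψ (x + M * y) = ψ x) {C : ℂ} (hC : ∀ y, fourier M ψ y = C * ψ y)
    (s : ℂ) :
    mellin (theta M ψ) s = -I / M * C * mellin (theta M ψ) (2 - s) := by
  have h := mellin_theta_functional_equation M hψ one_ne_zero (C := C)
    (fun y hy ↦ absurd (one_dvd y) hy) (fun y ↦ by rw [one_mul, hC]) s
  rw [h, Zsqrtd.norm_one, map_one]
  push_cast
  rw [one_cpow]
  ring

/-! ### Chinese remainder factorisation of the Fourier transform -/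

section CRT

variable {M₁ M₂ : ℕ} [NeZero M₁] [NeZero M₂]

/-- **Splitting of the additive character under CRT**: for coprime `M₁, M₂` and integers
`u₁, u₂` with `u₁ M₂ ≡ 1 (mod M₁)`, `u₂ M₁ ≡ 1 (mod M₂)`,
`e^{2πi j/(M₁M₂)} = e^{2πi u₁ j/M₁} e^{2πi u₂ j/M₂}` (`u₁ M₂ + u₂ M₁ ≡ 1 (mod M₁ M₂)`). [folklore] -/
theorem stdAddChar_mul_eq [NeZero (M₁ * M₂)] (hc : M₁.Coprime M₂) {u₁ u₂ : ℤ}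
    (hu₁ : u₁ * M₂ ≡ 1 [ZMOD M₁]) (hu₂ : u₂ * M₁ ≡ 1 [ZMOD M₂]) (j : ℤ) :
    ZMod.stdAddChar (j : ZMod (M₁ * M₂)) =
      ZMod.stdAddChar ((u₁ * j : ℤ) : ZMod M₁) * ZMod.stdAddChar ((u₂ * j : ℤ) : ZMod M₂) := by
  rw [ZMod.stdAddChar_coe, ZMod.stdAddChar_coe, ZMod.stdAddChar_coe, ← Complex.exp_add]
  -- `u₁ M₂ + u₂ M₁ = 1 + M₁ M₂ q`
  have h1 : (M₁ : ℤ) ∣ u₁ * M₂ + u₂ * M₁ - 1 := by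
    have h := Int.ModEq.dvd hu₁.symm
    have : u₁ * M₂ + u₂ * M₁ - 1 = (u₁ * M₂ - 1) + M₁ * u₂ := by ring
    rw [this]
    exact dvd_add h (dvd_mul_right _ _)
  have h2 : (M₂ : ℤ) ∣ u₁ * M₂ + u₂ * M₁ - 1 := by
    have h := Int.ModEq.dvd hu₂.symm
    have : u₁ * M₂ + u₂ * M₁ - 1 = (u₂ * M₁ - 1) + M₂ * u₁ := by ring
    rw [this]
    exact dvd_add h (dvd_mul_right _ _)
  have hcop : IsCoprime (M₁ : ℤ) (M₂ : ℤ) := Int.isCoprime_iff_gcd_eq_one.mpr (by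
    rw [Int.gcd_natCast_natCast]; exact hc)
  obtain ⟨q, hq⟩ := hcop.mul_dvd h1 h2
  have hM₁ : (M₁ : ℂ) ≠ 0 := Nat.cast_ne_zero.mpr (NeZero.ne M₁)
  have hM₂ : (M₂ : ℂ) ≠ 0 := Nat.cast_ne_zero.mpr (NeZero.ne M₂)
  have hq' : (u₁ : ℂ) * M₂ + u₂ * M₁ = 1 + M₁ * M₂ * q := by
    have := congrArg (fun z : ℤ ↦ (z : ℂ)) hq
    push_cast at this ⊢
    linear_combination this
  have key : 2 * π * I * ((u₁ * j : ℤ) : ℂ) / (M₁ : ℕ) + 2 * π * I * ((u₂ * j : ℤ) : ℂ) / (M₂ : ℕ) =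
      2 * π * I * (j : ℂ) / ((M₁ * M₂ : ℕ) : ℂ) + (j * q : ℤ) * (2 * π * I) := by
    push_cast
    field_simp
    linear_combination (j : ℂ) * hq'
  rw [key, Complex.exp_add, Complex.exp_int_mul_two_pi_mul_I, mul_one]


/-- The pairing character on an integer lift of its argument. [folklore] -/
lemma pairing_eq_stdAddChar_intCast (c : ZMod M × ZMod M) (y : ℤ[i]) :
    pairing M c y = ZMod.stdAddChar (((c.1.val : ℤ) * y.re + (c.2.val : ℤ) * y.im : ℤ) : ZMod M) := by
  rw [pairing]
  congr 1
  push_cast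
  rw [ZMod.natCast_zmod_val, ZMod.natCast_zmod_val]

/-- The CRT bijection on pairs of classes modulo `M₁ M₂` (Mathlib's `ZMod.chineseRemainder` on
each coordinate). [folklore] -/
def crtPairEquiv (hc : M₁.Coprime M₂) :
    ZMod (M₁ * M₂) × ZMod (M₁ * M₂) ≃ (ZMod M₁ × ZMod M₁) × (ZMod M₂ × ZMod M₂) :=
  ((ZMod.chineseRemainder hc).toEquiv.prodCongr (ZMod.chineseRemainder hc).toEquiv).trans
    (Equiv.prodProdProdComm _ _ _ _)

omit [NeZero M₁] [NeZero M₂] in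
/-- `ZMod.chineseRemainder` is the pair of reductions. [folklore] -/
lemma chineseRemainder_apply (hc : M₁.Coprime M₂) (x : ZMod (M₁ * M₂)) :
    ZMod.chineseRemainder hc x = (ZMod.cast x : ZMod M₁ × ZMod M₂) := rfl

omit [NeZero M₁] [NeZero M₂] in
/-- First component of `crtPairEquiv`: reduction modulo `M₁`. [folklore] -/
lemma crtPairEquiv_apply_fst [NeZero (M₁ * M₂)] (hc : M₁.Coprime M₂)
    (c : ZMod (M₁ * M₂) × ZMod (M₁ * M₂)) :
    (crtPairEquiv hc c).1 = ((c.1.val : ZMod M₁), (c.2.val : ZMod M₁)) := by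
  simp only [crtPairEquiv, Equiv.trans_apply, Equiv.prodCongr_apply, Prod.map,
    RingEquiv.toEquiv_eq_coe, EquivLike.coe_coe, chineseRemainder_apply,
    Equiv.prodProdProdComm_apply, ZMod.cast_eq_val, Prod.fst_natCast]

omit [NeZero M₁] [NeZero M₂] in
/-- Second component of `crtPairEquiv`: reduction modulo `M₂`. [folklore] -/
lemma crtPairEquiv_apply_snd [NeZero (M₁ * M₂)] (hc : M₁.Coprime M₂)
    (c : ZMod (M₁ * M₂) × ZMod (M₁ * M₂)) :
    (crtPairEquiv hc c).2 = ((c.1.val : ZMod M₂), (c.2.val : ZMod M₂)) := by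
  simp only [crtPairEquiv, Equiv.trans_apply, Equiv.prodCongr_apply, Prod.map,
    RingEquiv.toEquiv_eq_coe, EquivLike.coe_coe, chineseRemainder_apply,
    Equiv.prodProdProdComm_apply, ZMod.cast_eq_val, Prod.snd_natCast]

/-- **Chinese-remainder factorisation of the Fourier transform.** For coprime `M₁, M₂`,
coefficients `ψ₁` periodic modulo `M₁` and `ψ₂` periodic modulo `M₂`, and integers `u₁, u₂` with
`u₁ M₂ ≡ 1 (mod M₁)`, `u₂ M₁ ≡ 1 (mod M₂)`: the transform modulo `M₁ M₂` of `ψ₁ ψ₂` is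
`(ψ₁ψ₂)^(y) = ψ̂₁(u₁ y) ψ̂₂(u₂ y)` (the classical factorisation of Gauss sums). [folklore] -/
theorem fourier_mul_eq_of_coprime [NeZero (M₁ * M₂)] (hc : M₁.Coprime M₂) {ψ₁ ψ₂ : ℤ[i] → ℂ}
    (h₁ : ∀ x y : ℤ[i], ψ₁ (x + M₁ * y) = ψ₁ x) (h₂ : ∀ x y : ℤ[i], ψ₂ (x + M₂ * y) = ψ₂ x)
    {u₁ u₂ : ℤ} (hu₁ : u₁ * M₂ ≡ 1 [ZMOD M₁]) (hu₂ : u₂ * M₁ ≡ 1 [ZMOD M₂]) (y : ℤ[i]) :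
    fourier (M₁ * M₂) (fun x ↦ ψ₁ x * ψ₂ x) y =
      fourier M₁ ψ₁ (u₁ * y) * fourier M₂ ψ₂ (u₂ * y) := by
  set F₁ : ZMod M₁ × ZMod M₁ → ℂ := fun a ↦ ψ₁ (rep M₁ a 0) * pairing M₁ a (u₁ * y) with hF₁
  set F₂ : ZMod M₂ × ZMod M₂ → ℂ := fun b ↦ ψ₂ (rep M₂ b 0) * pairing M₂ b (u₂ * y) with hF₂
  calc fourier (M₁ * M₂) (fun x ↦ ψ₁ x * ψ₂ x) y
      = ∑ p : (ZMod M₁ × ZMod M₁) × (ZMod M₂ × ZMod M₂), F₁ p.1 * F₂ p.2 := by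
        unfold fourier
        refine Fintype.sum_equiv (crtPairEquiv hc) _ _ fun c ↦ ?_
        rw [crtPairEquiv_apply_fst, crtPairEquiv_apply_snd, hF₁, hF₂]
        dsimp only
        have e1 : ψ₁ (rep (M₁ * M₂) c 0) = ψ₁ (rep M₁ ((c.1.val : ZMod M₁), (c.2.val : ZMod M₁)) 0) :=
          apply_eq_of_cls_eq M₁ h₁ (by simp [cls, rep])
        have e2 : ψ₂ (rep (M₁ * M₂) c 0) = ψ₂ (rep M₂ ((c.1.val : ZMod M₂), (c.2.val : ZMod M₂)) 0) :=
          apply_eq_of_cls_eq M₂ h₂ (by simp [cls, rep])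
        have e3 : pairing (M₁ * M₂) c y =
            pairing M₁ ((c.1.val : ZMod M₁), (c.2.val : ZMod M₁)) (u₁ * y) *
              pairing M₂ ((c.1.val : ZMod M₂), (c.2.val : ZMod M₂)) (u₂ * y) := by
          rw [pairing_eq_stdAddChar_intCast, stdAddChar_mul_eq hc hu₁ hu₂, pairing, pairing,
            Zsqrtd.re_smul, Zsqrtd.im_smul, Zsqrtd.re_smul, Zsqrtd.im_smul]
          congr 2 <;> (push_cast; ring)
        rw [e1, e2, e3]
        ring
    _ = (∑ a, F₁ a) * ∑ b, F₂ b := by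
        rw [Fintype.sum_prod_type, Finset.sum_mul_sum]
    _ = fourier M₁ ψ₁ (u₁ * y) * fourier M₂ ψ₂ (u₂ * y) := rfl

end CRT

end GaussianTheta

end Literature.NumberTheory.LFunctions
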